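import Summits.QuantumFields.BalabanUV.Beta.LagrangeFoldSrec
import Summits.QuantumFields.BalabanUV.Beta.KernelWardHColumnWall

/-!
# `BalabanUV.Beta.LagrangeFoldWard` — binder row D1, (L4) W-side: THE FIRST-ORDER WARD LAW IN THE LAGRANGIAN CHART for the ADOPTED literal
# v2.26 tables (the `hD` input of the response pieces: `divV (dM G_j Lc (S_j^{pure}) (M1At … j)) y = conjV 𝕄_j (X_j y)`, every level, at the pin)
# (β sub-cell, D1 formalisation swarm, unit `b2b-balaban-beta-d1-formalise-leaf-10`, gen 2; CLAIM «D1-L4-FOLD»/«D1-hW-L4-SWAP» corollary)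

NOT IN PRINT; OUR BOOKKEEPING.  HONEST FRAMING (cell contract, verbatim): «discharging `BetaPertH` makes Bałaban's UV stability
UNCONDITIONAL — a real constructive-QFT result; it is NOT the continuum limit and NOT the Clay problem.»  HONEST DEPENDENCY (verbatim):
«continuum YM on T⁴ ⇐ BetaPertH ∧ nine spine estimates (0/9 proved); BetaPertH ⇐ (D1) ∧ (D4) ∧ CAP+tail; G-an2-4 gates asym, D1 and
NE2/3/4.»  [folklore] kernel algebra; instantiates NO binder of the β-function wall; no `[cite:]`, no `def`, no `def … : Prop`; NOT D1,
NOT `BetaPertH`, NOT continuum, NOT Clay.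

## What

For `G_j := coDressKBmAt (toSite r) Lc (KInvStep Lc j)` (in-block root `r`, `1 ≤ Lc`) and the pin `(cE, cVH) = (Lc^{d+1}, −Lc^{d+1}·½·Lc^{d+1})`,
the LAGRANGIAN-chart first-order vertex `dM G_j Lc (S_j^{pure}) (M1At d Lc (toSite r) cΛ j)` — `S_j^{pure}` = the displayed E+vh piece of
`SrecAt … j` (`S0NAt` at `j = 0`) — obeys the SAME pure-gauge Ward law as the folded vertex:
`divV (dM G_j Lc (S_j^{pure}) (M1At … j)) y = conjV (bhKStepAt d (toSite r) Lc j) (diagK (½ • Σ_{v∈box} legInd (toSite r) (Lc•y + v)))`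
(`divV_dM_pure_succ_eq_conjV`, `divV_dM_pure_zero_eq_conjV`).  Proof: (c1) (`LagrangeFoldSrec`) identifies the two vertices as FAMILIES; an1's
FILE-1 `KernelWardRelative.divV_vertexOfK_eq_conjV` + leaf-07's `colH_ward_KInvStep_all` + leaf-10's `WardLocusRecursive.hSd_SrecAt` give the law
for the folded vertex.  This is the `hD` hypothesis of `KernelWardSwapResponse.divW_resp_swap_coDressKBmAt_KInvStep_of_law_diag` and the
first-order input of an1's `KernelWardResponse`/`KernelWardResidual` for an2's literal tables.
-/

noncomputable section

open Finset
open scoped BigOperators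
open Literature.MathematicalPhysics.QuantumFieldTheory
open Literature.MathematicalPhysics.QuantumFieldTheory.Balaban1983to89
open Literature.MathematicalPhysics.QuantumFieldTheory.Balaban1983to89.Beta
open ExpKernelCalculus (MKer Decays)
open KernelWard (divV)
open AffineAveraging (box toSite)
open OneStepResolventKernel (Fib LocStencil)
open OneStepKernelFamily (KInvStep vertexOfK)
open StepJetData (wilsonA)
open AveragingHessianKernelsRooted (vhSAt)
open Summit.QuantumFields.BalabanUV.Beta.AveragingWardRootedStencils (legInd)
open BalabanStepJetsSucc (wE wVH)
open SecondOrderResponse (vertexOfM dM)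
open Summit.QuantumFields.BalabanUV.Beta.TameKernelCalculus
open Summit.QuantumFields.BalabanUV.Beta.ChartConjugation (conjV)
open Summit.QuantumFields.BalabanUV.Beta.BorderedHessian (diagK bhKStepAt stepScale)
open Summit.QuantumFields.BalabanUV.Beta.AxialDressingRooted (coDressKBmAt decays_coDressKBmAt_KInvStep one_le_of_neZero)
open Summit.QuantumFields.BalabanUV.Beta.SpineRooted (S0NAt M1At e3OfK)
open Summit.QuantumFields.BalabanUV.Beta.KernelWardRelative (divV_vertexOfK_eq_conjV)
open Summit.QuantumFields.BalabanUV.Beta.KernelWardHColumnWall (colH_ward_KInvStep_all)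
open Summit.QuantumFields.BalabanUV.Beta.WardLocusRecursive (SrecAt SrecAt_zero hSd_SrecAt locStencil_SrecAt)
open Summit.QuantumFields.BalabanUV.Beta.LagrangeFoldSrec (vertexOfK_SrecAt_succ_split vertexOfK_S0NAt_split)

namespace Summit.QuantumFields.BalabanUV.Beta.LagrangeFoldWard

variable {d : ℕ} {Lc : ℕ} [NeZero Lc] {r : Fin (d + 1) → ℕ}

/-- [folklore] **THE FOLDED VERTEX OBEYS THE FIRST-ORDER WARD LAW, EVERY LEVEL, AT THE PIN** (an1's FILE-1 law fed with leaf-07's (hH) and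
leaf-10's `hSd_SrecAt`): `divV (vertexOfK G_j Lc (SrecAt … j)) y = conjV (bhKStepAt j) (diagK (½ • Σ_v legInd (toSite r) (Lc•y + v)))`. -/
theorem divV_vertexOfK_SrecAt_eq_conjV (hr : r ∈ box (d + 1) Lc) (cΛ : ℝ) (j : ℕ) (y : Fin (d + 1) → ℤ) :
    divV (vertexOfK (coDressKBmAt (toSite r) Lc (KInvStep (d := d) Lc j)) Lc
        (SrecAt d Lc (toSite r) ((Lc : ℝ) ^ (d + 1)) (-((Lc : ℝ) ^ (d + 1) * (1 / 2) * (Lc : ℝ) ^ (d + 1))) cΛ j)) y =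
      conjV (bhKStepAt d (toSite r) Lc j) (diagK (((1 : ℝ) / 2) • ∑ v ∈ box (d + 1) Lc, legInd (toSite r) ((Lc : ℤ) • y + toSite v))) := by
  have hLc : 1 ≤ Lc := one_le_of_neZero Lc
  obtain ⟨Cs, δs, hδs, hS⟩ := locStencil_SrecAt (d := d) hLc hr ((Lc : ℝ) ^ (d + 1)) (-((Lc : ℝ) ^ (d + 1) * (1 / 2) * (Lc : ℝ) ^ (d + 1))) cΛ j
  exact divV_vertexOfK_eq_conjV (decays_coDressKBmAt_KInvStep hr j) hLc hS hδs _ (colH_ward_KInvStep_all hr j)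
    (fun y => hSd_SrecAt hLc hr cΛ j y) y

/-- [folklore] **THE LAGRANGIAN-CHART FIRST-ORDER WARD LAW FOR THE LITERAL TABLES, LEVEL `j+1`, AT THE PIN**: with `S^{pure}_{j+1}` the E+vh piece
of `SrecAt … (j+1)` and `M1At d Lc (toSite r) cΛ (j+1)`,
`divV (dM G_{j+1} Lc S^{pure}_{j+1} (M1At … (j+1))) y = conjV (bhKStepAt (j+1)) (diagK (½ • Σ_v legInd (toSite r) (Lc•y + v)))`. -/
theorem divV_dM_pure_succ_eq_conjV (hr : r ∈ box (d + 1) Lc) (cΛ : ℝ) (j : ℕ) (y : Fin (d + 1) → ℤ) :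
    divV (dM (coDressKBmAt (toSite r) Lc (KInvStep (d := d) Lc (j + 1))) Lc
        (fun κ' u' => ((Lc : ℝ) ^ (d + 1) * wE d Lc (j + 1)) •
            e3OfK Lc (coDressKBmAt (toSite r) Lc (KInvStep (d := d) Lc j))
              (SrecAt d Lc (toSite r) ((Lc : ℝ) ^ (d + 1)) (-((Lc : ℝ) ^ (d + 1) * (1 / 2) * (Lc : ℝ) ^ (d + 1))) cΛ j) κ' u' +
          (-((Lc : ℝ) ^ (d + 1) * (1 / 2) * (Lc : ℝ) ^ (d + 1)) * wVH d Lc (j + 1)) • vhSAt (toSite r) d Lc rfl κ' u')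
        (M1At d Lc (toSite r) cΛ (j + 1))) y =
      conjV (bhKStepAt d (toSite r) Lc (j + 1)) (diagK (((1 : ℝ) / 2) • ∑ v ∈ box (d + 1) Lc, legInd (toSite r) ((Lc : ℤ) • y + toSite v))) := by
  have e : dM (coDressKBmAt (toSite r) Lc (KInvStep (d := d) Lc (j + 1))) Lc
        (fun κ' u' => ((Lc : ℝ) ^ (d + 1) * wE d Lc (j + 1)) •
            e3OfK Lc (coDressKBmAt (toSite r) Lc (KInvStep (d := d) Lc j))
              (SrecAt d Lc (toSite r) ((Lc : ℝ) ^ (d + 1)) (-((Lc : ℝ) ^ (d + 1) * (1 / 2) * (Lc : ℝ) ^ (d + 1))) cΛ j) κ' u' +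
          (-((Lc : ℝ) ^ (d + 1) * (1 / 2) * (Lc : ℝ) ^ (d + 1)) * wVH d Lc (j + 1)) • vhSAt (toSite r) d Lc rfl κ' u')
        (M1At d Lc (toSite r) cΛ (j + 1)) =
      vertexOfK (coDressKBmAt (toSite r) Lc (KInvStep (d := d) Lc (j + 1))) Lc
        (SrecAt d Lc (toSite r) ((Lc : ℝ) ^ (d + 1)) (-((Lc : ℝ) ^ (d + 1) * (1 / 2) * (Lc : ℝ) ^ (d + 1))) cΛ (j + 1)) := by
    funext μ y'
    rw [show dM (coDressKBmAt (toSite r) Lc (KInvStep (d := d) Lc (j + 1))) Lc _ (M1At d Lc (toSite r) cΛ (j + 1)) μ y' =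
        vertexOfK (coDressKBmAt (toSite r) Lc (KInvStep (d := d) Lc (j + 1))) Lc _ μ y' +
          vertexOfM (coDressKBmAt (toSite r) Lc (KInvStep (d := d) Lc (j + 1))) Lc (M1At d Lc (toSite r) cΛ (j + 1)) μ y' from rfl,
      vertexOfK_SrecAt_succ_split hr _ _ cΛ j μ y']
  rw [e]
  exact divV_vertexOfK_SrecAt_eq_conjV hr cΛ (j + 1) y

/-- [folklore] **… LEVEL 0, AT THE PIN**: with `S^{pure}_0 := cE • wilsonA + cVH • vhSAt` (native placement) and `M1At d Lc (toSite r) cΛ 0`. -/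
theorem divV_dM_pure_zero_eq_conjV (hr : r ∈ box (d + 1) Lc) (cΛ : ℝ) (y : Fin (d + 1) → ℤ) :
    divV (dM (coDressKBmAt (toSite r) Lc (KInvStep (d := d) Lc 0)) Lc
        (fun κ' u' => ((Lc : ℝ) ^ (d + 1)) • wilsonA d κ' u' + (-((Lc : ℝ) ^ (d + 1) * (1 / 2) * (Lc : ℝ) ^ (d + 1))) • vhSAt (toSite r) d Lc rfl κ' u')
        (M1At d Lc (toSite r) cΛ 0)) y =
      conjV (bhKStepAt d (toSite r) Lc 0) (diagK (((1 : ℝ) / 2) • ∑ v ∈ box (d + 1) Lc, legInd (toSite r) ((Lc : ℤ) • y + toSite v))) := by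
  have e : dM (coDressKBmAt (toSite r) Lc (KInvStep (d := d) Lc 0)) Lc
        (fun κ' u' => ((Lc : ℝ) ^ (d + 1)) • wilsonA d κ' u' + (-((Lc : ℝ) ^ (d + 1) * (1 / 2) * (Lc : ℝ) ^ (d + 1))) • vhSAt (toSite r) d Lc rfl κ' u')
        (M1At d Lc (toSite r) cΛ 0) =
      vertexOfK (coDressKBmAt (toSite r) Lc (KInvStep (d := d) Lc 0)) Lc
        (SrecAt d Lc (toSite r) ((Lc : ℝ) ^ (d + 1)) (-((Lc : ℝ) ^ (d + 1) * (1 / 2) * (Lc : ℝ) ^ (d + 1))) cΛ 0) := by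
    funext μ y'
    rw [SrecAt_zero,
      show dM (coDressKBmAt (toSite r) Lc (KInvStep (d := d) Lc 0)) Lc _ (M1At d Lc (toSite r) cΛ 0) μ y' =
        vertexOfK (coDressKBmAt (toSite r) Lc (KInvStep (d := d) Lc 0)) Lc _ μ y' +
          vertexOfM (coDressKBmAt (toSite r) Lc (KInvStep (d := d) Lc 0)) Lc (M1At d Lc (toSite r) cΛ 0) μ y' from rfl,
      vertexOfK_S0NAt_split hr _ _ cΛ μ y']
  rw [e]
  exact divV_vertexOfK_SrecAt_eq_conjV hr cΛ 0 y

end Summit.QuantumFields.BalabanUV.Beta.LagrangeFoldWard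

end
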